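import Mathlib
import Summits.Ventures.HodgeRepro2.T5InducedLatticeUnits
import Summits.Ventures.HodgeRepro2.T5TateComparison
import Summits.Ventures.HodgeRepro2.T5AdicCompletionNormSurjective

/-!
# The principal units of the induced lattice are cohomologically trivial: `h⁰ = h⁻¹` on the units

`Kv ⊆ Lw`, `[Lw : Kv] = 2`, `σ ≠ 1`, `θ ∈ O_Lw` non-zero anti-invariant, `V = principalUnits θ γ`
(`T5InducedLatticeUnits`) at a level `γ` with `γ κ κ < 1`:

* `exists_normConj_eq`: every `σ`-FIXED element of `1 + lat γ` is a norm `c · σ c` with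
  `c ∈ 1 + lat γ` (`Ĥ⁰(V) = 0`);
* `exists_mul_algEquiv_eq`: every NORM-ONE element `y` of `1 + lat γ` satisfies `y · σ c = c` for
  some `c ∈ 1 + lat γ`, i.e. `y = c / σ c` (`Ĥ⁻¹(V) = 0`).

Both by the successive approximation of `T5InducedLatticeUnits` (the residual level is multiplied by
`ρ = γ κ κ < 1` at each step: `exists_normConj_iter`, `exists_diff_iter`) and the Cantor argument of
`T5AdicCompletionNormSurjective` (closed, decreasing, non-empty subsets of the compact `O_Lw`;
`exists_of_forall_exists_val_le`).

* `relIndex_eq_on_adicIntegerUnits`: THE CONSEQUENCE, through `T5TateComparison`: on the integer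
  units `U = O_Lwˣ` of `Lw`, `[U^σ : N U] = [ker N ∩ U : D U]` — the Herbrand quotient of the units
  is `1` (Serre, *Local Class Field Theory* (Cassels–Fröhlich Ch. VI) §1.4 Prop. 3 Method 2 + Cor. 1
  — held as Œuvres II no. 75, scan pp. 405–406 (Method 2: `V = 1 + M`, `M = π^i A`, `A` free over
  `O_K[G]`) — and *Local Fields* Ch. VIII §4 Prop. 7 + Cor., for `G` of order `2`, at EVERY residue
  characteristic).

Declaration per README §8(d): «uses an L-value-free non-vanishing device: NO».
-/

namespace Summit.Ventures.HodgeRepro2.T5InducedLatticeCohomology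

open IsDedekindDomain HeightOneSpectrum WithZero T5InducedLattice T5InducedLatticeUnits

variable {K : Type*} [Field K] [NumberField K] (v : HeightOneSpectrum (NumberField.RingOfIntegers K))
  {L : Type*} [Field L] [NumberField L] [Algebra K L]
  (w : HeightOneSpectrum (NumberField.RingOfIntegers L)) [w.asIdeal.LiesOver v.asIdeal]
  (σ : Gal(adicCompletion L w/adicCompletion K v))
  (h2 : Module.finrank (adicCompletion K v) (adicCompletion L w) = 2) (hσ : σ ≠ 1)
  {θ : adicCompletion L w} (hθ : σ θ = -θ) (hθ0 : θ ≠ 0) (hθ1 : Valued.v θ ≤ 1)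
  {γ : WithZero (Multiplicative ℤ)} (hγ1 : γ < 1) (hρ : γ * kappa v w θ * kappa v w θ ≤ 1)

section Iteration

include hθ0 hθ1 hρ in
/-- `γ κ ≤ 1` from `γ κ κ ≤ 1` (`1 ≤ κ`). -/
theorem mul_kappa_le_one : γ * kappa v w θ ≤ 1 :=
  (le_mul_of_one_le_right' (one_le_kappa v w hθ0 hθ1)).trans hρ

include hρ in
/-- `γ ρ^n ≤ γ`. -/
theorem mul_pow_le (n : ℕ) : γ * (γ * kappa v w θ * kappa v w θ) ^ n ≤ γ :=
  mul_le_of_le_one_right' (pow_le_one₀ zero_le hρ)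

include h2 hσ hθ hθ0 hθ1 hγ1 hρ in
/-- THE ITERATION FOR `Ĥ⁰`: for a `σ`-fixed `y ∈ 1 + lat γ` and every `n`, there is `c ∈ 1 + lat γ` with
`y / N(c)` `σ`-fixed in `1 + lat (γ ρ^n)`, `ρ = γ κ κ`. -/
theorem exists_normConj_iter {y : adicCompletion L w} (hy : y - 1 ∈ lat v w θ γ) (hfix : σ y = y)
    (n : ℕ) : ∃ c : adicCompletion L w, c - 1 ∈ lat v w θ γ ∧
      σ (y / (c * σ c)) = y / (c * σ c) ∧
      y / (c * σ c) - 1 ∈ lat v w θ (γ * (γ * kappa v w θ * kappa v w θ) ^ n) := by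
  induction n with
  | zero =>
    refine ⟨1, by simpa using zero_mem_lat v w θ γ, ?_, ?_⟩
    · rw [map_one, mul_one, div_one, hfix]
    · rw [map_one, mul_one, div_one, pow_zero, mul_one]; exact hy
  | succ n ih =>
    obtain ⟨c, hc, hfix', hres⟩ := ih
    set γn := γ * (γ * kappa v w θ * kappa v w θ) ^ n with hγn
    have hγn1 : γn < 1 := lt_of_le_of_lt (mul_pow_le v w hρ n) hγ1
    obtain ⟨c', hc', hfix'', hres'⟩ :=
      exists_normConj_approx v w σ h2 hσ hθ hθ0 hθ1 hγn1 hres hfix'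
    have hcγ : c' - 1 ∈ lat v w θ γ := lat_mono v w (mul_pow_le v w hρ n) hc'
    refine ⟨c * c', mul_sub_one_mem_lat v w σ h2 hσ hθ hθ0 hθ1 (mul_kappa_le_one v w hθ0 hθ1 hρ) hc hcγ,
      ?_, ?_⟩
    · have e : y / (c * c' * σ (c * c')) = y / (c * σ c) / (c' * σ c') := by
        rw [map_mul, div_div]; congr 1; ring
      rw [e]; exact hfix''
    · have e : y / (c * c' * σ (c * c')) = y / (c * σ c) / (c' * σ c') := by
        rw [map_mul, div_div]; congr 1; ring
      rw [e]
      refine lat_mono v w ?_ hres'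
      have hle : γn ≤ γ := mul_pow_le v w hρ n
      calc γn * (γn * kappa v w θ * kappa v w θ) ≤ γn * (γ * kappa v w θ * kappa v w θ) :=
            mul_le_mul_right (mul_le_mul_left (mul_le_mul_left hle _) _) γn
        _ = γ * (γ * kappa v w θ * kappa v w θ) ^ (n + 1) := by rw [hγn, pow_succ, mul_assoc]

include h2 hσ hθ hθ0 hθ1 hγ1 hρ in
/-- THE ITERATION FOR `Ĥ⁻¹`: for a norm-one `y ∈ 1 + lat γ` and every `n`, there is `c ∈ 1 + lat γ`
with `y σ c / c` of norm one in `1 + lat (γ ρ^n)`. -/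
theorem exists_diff_iter {y : adicCompletion L w} (hy : y - 1 ∈ lat v w θ γ) (hN : y * σ y = 1)
    (n : ℕ) : ∃ c : adicCompletion L w, c - 1 ∈ lat v w θ γ ∧
      (y * σ c / c) * σ (y * σ c / c) = 1 ∧
      y * σ c / c - 1 ∈ lat v w θ (γ * (γ * kappa v w θ * kappa v w θ) ^ n) := by
  induction n with
  | zero =>
    refine ⟨1, by simpa using zero_mem_lat v w θ γ, ?_, ?_⟩
    · rw [map_one, mul_one, div_one, hN]
    · rw [map_one, mul_one, div_one, pow_zero, mul_one]; exact hy
  | succ n ih =>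
    obtain ⟨c, hc, hN', hres⟩ := ih
    set γn := γ * (γ * kappa v w θ * kappa v w θ) ^ n with hγn
    have hγn1 : γn < 1 := lt_of_le_of_lt (mul_pow_le v w hρ n) hγ1
    obtain ⟨c', hc', hN'', hres'⟩ :=
      exists_diff_approx v w σ h2 hσ hθ hθ0 hθ1 hγn1 hres hN'
    have hcγ : c' - 1 ∈ lat v w θ γ := lat_mono v w (mul_pow_le v w hρ n) hc'
    have hc0 : c ≠ 0 := by
      intro h0
      have := val_eq_one_of_sub_one_mem_lat v w hγ1 hc hθ1
      rw [h0, map_zero] at this; exact zero_ne_one this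
    have hc'0 : c' ≠ 0 := by
      intro h0
      have := val_eq_one_of_sub_one_mem_lat v w hγ1 hcγ hθ1
      rw [h0, map_zero] at this; exact zero_ne_one this
    have e : y * σ (c * c') / (c * c') = y * σ c / c * σ c' / c' := by
      rw [map_mul]; field_simp
    refine ⟨c * c', mul_sub_one_mem_lat v w σ h2 hσ hθ hθ0 hθ1 (mul_kappa_le_one v w hθ0 hθ1 hρ) hc hcγ,
      ?_, ?_⟩
    · rw [e]; exact hN''
    · rw [e]
      refine lat_mono v w ?_ hres'
      have hle : γn ≤ γ := mul_pow_le v w hρ n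
      calc γn * (γn * kappa v w θ * kappa v w θ) ≤ γn * (γ * kappa v w θ * kappa v w θ) :=
            mul_le_mul_right (mul_le_mul_left (mul_le_mul_left hle _) _) γn
        _ = γ * (γ * kappa v w θ * kappa v w θ) ^ (n + 1) := by rw [hγn, pow_succ, mul_assoc]

end Iteration

section Cantor

/-- THE CANTOR ARGUMENT: `S ⊆ O_Lw` closed, `f` continuous, and `f c` approximates `y` within `γ₀ ρ^n`
on `S` for every `n` (`ρ < 1`) ⇒ `f c = y` for some `c ∈ S`. -/
theorem exists_of_forall_exists_val_le {S : Set (adicCompletion L w)} (hS : IsClosed S)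
    (hS1 : ∀ c ∈ S, Valued.v c ≤ 1) {f : adicCompletion L w → adicCompletion L w}
    (hf : Continuous f) (y : adicCompletion L w) {γ₀ ρ : WithZero (Multiplicative ℤ)} (hρ : ρ < 1)
    (h : ∀ n : ℕ, ∃ c ∈ S, Valued.v (f c - y) ≤ γ₀ * ρ ^ n) : ∃ c ∈ S, f c = y := by
  let t : ℕ → Set (adicCompletion L w) := fun n => S ∩ {c | Valued.v (f c - y) ≤ γ₀ * ρ ^ n}
  have hdec : ∀ n, t (n + 1) ⊆ t n := by
    intro n c hc
    refine ⟨hc.1, ?_⟩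
    show Valued.v (f c - y) ≤ γ₀ * ρ ^ n
    refine le_trans hc.2 ?_
    rw [pow_succ, ← mul_assoc]
    exact mul_le_of_le_one_right' hρ.le
  have hne : ∀ n, (t n).Nonempty := fun n => by
    obtain ⟨c, hcS, hc⟩ := h n
    exact ⟨c, hcS, hc⟩
  have hclosed : ∀ n, IsClosed (t n) := fun n =>
    hS.inter ((isClosed_setOf_val_le _).preimage (hf.sub continuous_const))
  have hcompact : IsCompact (t 0) := by
    refine (T5AdicCompletionGaloisInvariance.isCompact_adicCompletionIntegers w).of_isClosed_subset
      (hclosed 0) ?_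
    intro c hc
    exact (mem_adicCompletionIntegers _ _ _).mpr (hS1 c hc.1)
  obtain ⟨c, hc⟩ := IsCompact.nonempty_iInter_of_sequence_nonempty_isCompact_isClosed t hdec hne
    hcompact hclosed
  rw [Set.mem_iInter] at hc
  refine ⟨c, (hc 0).1, ?_⟩
  rw [← sub_eq_zero]
  exact eq_zero_of_forall_val_le_mul_pow w hρ fun n => (hc n).2

end Cantor

section Consequences

variable (hρ' : γ * kappa v w θ * kappa v w θ < 1)

include h2 hσ hθ hθ0 hθ1 in
/-- `{c | c − 1 ∈ lat θ γ}` is closed. -/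
theorem isClosed_setOf_sub_one_mem_lat (hγ0 : γ ≠ 0) :
    IsClosed {c : adicCompletion L w | c - 1 ∈ lat v w θ γ} := by
  have : IsClosed (lat v w θ γ) := by
    rw [← coe_latAddSubgroup]
    exact AddSubgroup.isClosed_of_isOpen _ (isOpen_lat v w σ h2 hσ hθ hθ0 hθ1 hγ0)
  exact this.preimage (continuous_id.sub continuous_const)

include h2 hσ hθ hθ0 hθ1 hγ1 hρ' in
/-- `Ĥ⁰(V) = 0`: a `σ`-fixed element of `1 + lat γ` is `c · σ c` with `c ∈ 1 + lat γ`. -/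
theorem exists_normConj_eq (hγ0 : γ ≠ 0) {y : adicCompletion L w} (hy : y - 1 ∈ lat v w θ γ)
    (hfix : σ y = y) : ∃ c : adicCompletion L w, c - 1 ∈ lat v w θ γ ∧ c * σ c = y := by
  have happrox : ∀ n : ℕ, ∃ c ∈ {c : adicCompletion L w | c - 1 ∈ lat v w θ γ},
      Valued.v ((fun c => c * σ c) c - y) ≤ γ * (γ * kappa v w θ * kappa v w θ) ^ n := by
    intro n
    obtain ⟨c, hc, -, hres⟩ := exists_normConj_iter v w σ h2 hσ hθ hθ0 hθ1 hγ1 hρ'.le hy hfix n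
    refine ⟨c, hc, ?_⟩
    have hcv : Valued.v c = 1 := val_eq_one_of_sub_one_mem_lat v w hγ1 hc hθ1
    have hNv : Valued.v (c * σ c) = 1 := by
      rw [map_mul, T5AdicCompletionGaloisInvariance.val_algEquiv_apply v w σ, hcv, mul_one]
    have hN0 : c * σ c ≠ 0 := by
      intro h0; rw [h0, map_zero] at hNv; exact zero_ne_one hNv
    have e : c * σ c - y = -((c * σ c) * (y / (c * σ c) - 1)) := by
      rw [mul_sub, mul_one, mul_div_cancel₀ y hN0, neg_sub]
    show Valued.v (c * σ c - y) ≤ _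
    rw [e, Valuation.map_neg, map_mul, hNv, one_mul]
    exact val_le_of_mem_lat v w hθ1 hres
  exact exists_of_forall_exists_val_le w (isClosed_setOf_sub_one_mem_lat v w σ h2 hσ hθ hθ0 hθ1 hγ0)
    (fun c hc => (val_eq_one_of_sub_one_mem_lat v w hγ1 hc hθ1).le)
    (continuous_id.mul (T5AdicCompletionGaloisInvariance.continuous_algEquiv v w σ)) y hρ' happrox

include h2 hσ hθ hθ0 hθ1 hγ1 hρ' in
/-- `Ĥ⁻¹(V) = 0`: a norm-one element `y` of `1 + lat γ` satisfies `y · σ c = c` for some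
`c ∈ 1 + lat γ` (so `y = c / σ c`). -/
theorem exists_mul_algEquiv_eq (hγ0 : γ ≠ 0) {y : adicCompletion L w} (hy : y - 1 ∈ lat v w θ γ)
    (hN : y * σ y = 1) : ∃ c : adicCompletion L w, c - 1 ∈ lat v w θ γ ∧ y * σ c = c := by
  have happrox : ∀ n : ℕ, ∃ c ∈ {c : adicCompletion L w | c - 1 ∈ lat v w θ γ},
      Valued.v ((fun c => y * σ c - c) c - 0) ≤ γ * (γ * kappa v w θ * kappa v w θ) ^ n := by
    intro n
    obtain ⟨c, hc, -, hres⟩ := exists_diff_iter v w σ h2 hσ hθ hθ0 hθ1 hγ1 hρ'.le hy hN n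
    refine ⟨c, hc, ?_⟩
    have hcv : Valued.v c = 1 := val_eq_one_of_sub_one_mem_lat v w hγ1 hc hθ1
    have hc0 : c ≠ 0 := by
      intro h0; rw [h0, map_zero] at hcv; exact zero_ne_one hcv
    have e : y * σ c - c - 0 = c * (y * σ c / c - 1) := by
      rw [sub_zero, mul_sub, mul_one, mul_div_cancel₀ _ hc0]
    show Valued.v (y * σ c - c - 0) ≤ _
    rw [e, map_mul, hcv, one_mul]
    exact val_le_of_mem_lat v w hθ1 hres
  obtain ⟨c, hc, hfc⟩ := exists_of_forall_exists_val_le w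
    (isClosed_setOf_sub_one_mem_lat v w σ h2 hσ hθ hθ0 hθ1 hγ0)
    (fun c hc => (val_eq_one_of_sub_one_mem_lat v w hγ1 hc hθ1).le)
    ((continuous_const.mul (T5AdicCompletionGaloisInvariance.continuous_algEquiv v w σ)).sub
      continuous_id) 0 hρ' happrox
  exact ⟨c, hc, sub_eq_zero.mp hfc⟩

/-- The integer units are `σ`-stable. -/
theorem unitsAut_mem_adicIntegerUnits {y : (adicCompletion L w)ˣ}
    (hy : y ∈ T5AdicCompletionEmbedding.adicIntegerUnits w) :
    unitsAut v w σ y ∈ T5AdicCompletionEmbedding.adicIntegerUnits w := by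
  rw [T5AdicCompletionEmbedding.mem_adicIntegerUnits_iff, mem_adicCompletionIntegers,
    mem_adicCompletionIntegers] at hy ⊢
  rw [coe_unitsAut, ← map_inv, coe_unitsAut, T5AdicCompletionGaloisInvariance.val_algEquiv_apply v w σ,
    T5AdicCompletionGaloisInvariance.val_algEquiv_apply v w σ]
  exact hy

include h2 hσ hθ hθ0 hθ1 in
/-- THE HERBRAND QUOTIENT OF THE UNITS IS `1`: on `U = O_Lwˣ ⊆ Lwˣ`,
`[U^σ : N U] = [ker N ∩ U : D U]` (relative indices in `Lwˣ`, `N = normHom`, `D = diffHom` of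
`T5TateComparison` for the involution `unitsAut σ`). -/
theorem relIndex_eq_on_adicIntegerUnits :
    ((T5AdicCompletionEmbedding.adicIntegerUnits w).map (T5TateComparison.normHom (unitsAut v w σ))).relIndex
        ((T5TateComparison.diffHom (unitsAut v w σ)).ker ⊓ T5AdicCompletionEmbedding.adicIntegerUnits w) =
      ((T5AdicCompletionEmbedding.adicIntegerUnits w).map (T5TateComparison.diffHom (unitsAut v w σ))).relIndex
        ((T5TateComparison.normHom (unitsAut v w σ)).ker ⊓ T5AdicCompletionEmbedding.adicIntegerUnits w) := by
  -- the level `γ = (κ κ)⁻¹ · exp (−1)`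
  have hκ0 : kappa v w θ ≠ 0 := kappa_ne_zero v w hθ0 hθ1
  have hκ1 : 1 ≤ kappa v w θ := one_le_kappa v w hθ0 hθ1
  set γ : WithZero (Multiplicative ℤ) := (kappa v w θ * kappa v w θ)⁻¹ * exp (-1) with hγ
  have hκκ0 : kappa v w θ * kappa v w θ ≠ 0 := mul_ne_zero hκ0 hκ0
  have hγκκ : γ * kappa v w θ * kappa v w θ = exp (-1) := by
    rw [hγ, mul_assoc, mul_comm, ← mul_assoc, mul_inv_cancel₀ hκκ0, one_mul]
  have hexp : exp (-1 : ℤ) < 1 := by rw [← exp_zero, exp_lt_exp]; norm_num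
  have hρ' : γ * kappa v w θ * kappa v w θ < 1 := by rw [hγκκ]; exact hexp
  have hγ0 : γ ≠ 0 := mul_ne_zero (inv_ne_zero hκκ0) exp_ne_zero
  have hγ1 : γ < 1 := by
    have h1 : (kappa v w θ * kappa v w θ)⁻¹ ≤ 1 := by
      rw [inv_le_one₀ (lt_of_le_of_ne zero_le hκκ0.symm)]
      exact one_le_mul_of_one_le_of_one_le hκ1 hκ1
    calc γ = (kappa v w θ * kappa v w θ)⁻¹ * exp (-1) := hγ
      _ ≤ 1 * exp (-1) := mul_le_mul_left h1 _
      _ < 1 := by rw [one_mul]; exact hexp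
  have hγκ : γ * kappa v w θ ≤ 1 := mul_kappa_le_one v w hθ0 hθ1 hρ'.le
  haveI := finiteIndex_principalUnits_subgroupOf v w σ h2 hσ hθ hθ0 hθ1 hγκ hγ1 hγ0
  refine T5TateComparison.relIndex_eq_of_subgroup_of_le (unitsAut v w σ) (unitsAut_unitsAut v w σ h2 hσ)
    (T5AdicCompletionEmbedding.adicIntegerUnits w) (fun b hb => unitsAut_mem_adicIntegerUnits v w σ hb)
    (principalUnits v w σ h2 hσ hθ hθ0 hθ1 hγκ hγ1)
    (principalUnits_le_adicIntegerUnits v w σ h2 hσ hθ hθ0 hθ1 hγκ hγ1)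
    (fun b hb => unitsAut_mem_principalUnits v w σ h2 hσ hθ hθ0 hθ1 hγκ hγ1 hb) ?_ ?_
  · -- `Ĥ⁰(V) = 0`
    intro b hb hfix
    rw [mem_principalUnits_iff] at hb
    have hfix' : σ (b : adicCompletion L w) = b := congrArg Units.val hfix
    obtain ⟨c, hc, hcN⟩ := exists_normConj_eq v w σ h2 hσ hθ hθ0 hθ1 hγ1 hρ' hγ0 hb hfix'
    have hcv : Valued.v c = 1 := val_eq_one_of_sub_one_mem_lat v w hγ1 hc hθ1
    have hc0 : c ≠ 0 := by
      intro h0; rw [h0, map_zero] at hcv; exact zero_ne_one hcv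
    refine ⟨Units.mk0 c hc0, ?_, ?_⟩
    · rw [mem_principalUnits_iff, Units.val_mk0]; exact hc
    · apply Units.ext
      rw [Units.val_mul, coe_unitsAut, Units.val_mk0]
      exact hcN
  · -- `Ĥ⁻¹(V) = 0`
    intro b hb hN
    rw [mem_principalUnits_iff] at hb
    have hN' : (b : adicCompletion L w) * σ b = 1 := by
      have := congrArg Units.val hN
      rwa [Units.val_mul, coe_unitsAut, Units.val_one] at this
    obtain ⟨c, hc, hcD⟩ := exists_mul_algEquiv_eq v w σ h2 hσ hθ hθ0 hθ1 hγ1 hρ' hγ0 hb hN'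
    have hcv : Valued.v c = 1 := val_eq_one_of_sub_one_mem_lat v w hγ1 hc hθ1
    have hc0 : c ≠ 0 := by
      intro h0; rw [h0, map_zero] at hcv; exact zero_ne_one hcv
    have hσc0 : σ c ≠ 0 := by
      intro h0
      have := T5AdicCompletionGaloisInvariance.val_algEquiv_apply v w σ c
      rw [h0, map_zero, hcv] at this; exact zero_ne_one this
    refine ⟨Units.mk0 c hc0, ?_, ?_⟩
    · rw [mem_principalUnits_iff, Units.val_mk0]; exact hc
    · apply Units.ext
      rw [Units.val_mul, Units.val_inv_eq_inv_val, coe_unitsAut, Units.val_mk0,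
        mul_inv_eq_iff_eq_mul₀ hσc0]
      exact hcD.symm

end Consequences

end Summit.Ventures.HodgeRepro2.T5InducedLatticeCohomology
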